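import Literature.Analysis.Complex.CarlsonTheorem
import Mathlib.Analysis.SpecialFunctions.Pow.Deriv
import Mathlib.Analysis.Calculus.Deriv.Polynomial
import Mathlib.Analysis.Calculus.ParametricIntegral
import Mathlib.Analysis.Complex.CauchyIntegral
import Mathlib.Analysis.Complex.Convex
import Mathlib.MeasureTheory.Integral.Bochner.Basic
import HarnessLib

/-!
# Complex moments of a bounded non-negative random variable: polynomial recursions of the even
# moments lift to functional equations (Carlson's theorem)

Let `X` be a random variable with `0 ≤ X ≤ M` and law `μ`, and let `W(s) = E X^s = ∫ x^s dμ(x)`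
be its complex moment function (holomorphic on `Re s > 0`, bounded by `max(M,1)^{Re s}`). If the
even moments `m_k = E X^{2k}` satisfy a linear recursion with polynomial coefficients,
`Σ_{i ≤ d} P_i(k) m_{k+i} = 0` for all `k ∈ ℕ`, then

  `Σ_{i ≤ d} P_i(s/2) W(s + 2i) = 0`   for all `Re s > 0`.

This is the mechanism by which Borwein–Nuyens–Straub–Wan and Borwein–Straub–Wan–Zudilin pass from
the combinatorial recursions of the even moments `W_n(2k) = Σ (k!/(a₁!⋯a_n!))²` of short uniform
random walks to the functional equations of `W_n(s)`: "it followed that `W_n(s)` satisfies a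
functional equation, as in [bnsw-rw], coming from the inevitable recursion that exists for the
right-hand side of (Wn-even)" [BorweinEtAl2012, §2], the tool being **Carlson's theorem**
(`Literature.Analysis.Complex.AndrewsAskeyRoy1999_thm_2_8_1_holds`, AAR Thm. 2.8.1). Everything
here is PROVED, for a general finite measure `μ` on `ℝ` carried by `[0, M]`:

* `Literature.Analysis.Moments.cmoment μ s = ∫ x^s dμ` — measurability, the bound
  `‖W(s)‖ ≤ μ(ℝ)·max(M,1)^{Re s}` (`Re s ≥ 0`), holomorphy on `Re s > 0`
  (differentiation under the integral sign), and `W(2k) = ∫ x^{2k} dμ`;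
* `Literature.Analysis.Moments.cmoment_functionalEquation` — the lifting theorem above. Proof: the
  function `u ↦ max(M,1)^{−(2u+2+2d)} (u+2)^{−N} Σ_i P_i(u+1) W(2u+2+2i)` is holomorphic near
  `Re u ≥ 0`, bounded there, and vanishes on `ℕ`; Carlson's theorem makes it vanish for
  `Re u ≥ 0`, i.e. the equation holds for `Re s ≥ 2`, and the identity theorem on the half-plane
  of holomorphy `Re s > 0` finishes.

## References

* [BorweinEtAl2012] J. M. Borwein, A. Straub, J. Wan, W. Zudilin, *Densities of short uniform
  random walks*, Canad. J. Math. 64 (2012) 961–990 (arXiv:1103.2995), §2 (before Example 1).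
* J. M. Borwein, D. Nuyens, A. Straub, J. Wan, *Some arithmetic properties of short random walk
  integrals*, Ramanujan J. 26 (2011) 109–132, §2 (functional equations via Carlson's theorem).
* G. E. Andrews, R. Askey, R. Roy, *Special Functions* (CUP 1999), Thm. 2.8.1. [`AndrewsAskeyRoy1999`]
-/

noncomputable section

open MeasureTheory Set Real Complex Filter Topology Metric Polynomial
open scoped Polynomial
open Literature.Analysis.Complex

namespace Literature.Analysis.Moments

variable {μ : Measure ℝ}

/-! ### The complex moment function -/

/-- **The complex moment function** `W(s) = ∫ x^s dμ(x)` of a measure on `ℝ` (for the law of a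
random variable `X ≥ 0`: `W(s) = E X^s`; complex power, `0^s = 0` for `s ≠ 0`).
[cite: BorweinEtAl2012, §2 (the moments W_n(s))] -/
def cmoment (μ : Measure ℝ) (s : ℂ) : ℂ := ∫ x, (x : ℂ) ^ s ∂μ

/-- Measurability of `x ↦ x^s`. [folklore] -/
theorem measurable_ofReal_cpow (s : ℂ) : Measurable fun x : ℝ => (x : ℂ) ^ s :=
  Complex.measurable_ofReal.pow_const s

/-- `‖x^s‖ ≤ max(M,1)^{Re s}` for `0 ≤ x ≤ M` and `Re s ≥ 0`. [folklore] -/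
theorem norm_ofReal_cpow_le {x M : ℝ} (hx0 : 0 ≤ x) (hxM : x ≤ M) {s : ℂ} (hs : 0 ≤ s.re) :
    ‖(x : ℂ) ^ s‖ ≤ (max M 1) ^ s.re := by
  have hM1 : (1 : ℝ) ≤ max M 1 := le_max_right _ _
  rcases hx0.eq_or_lt with h | h
  · rw [← h, Complex.ofReal_zero]
    rcases eq_or_ne s 0 with hs0 | hs0
    · rw [hs0, cpow_zero, zero_re, Real.rpow_zero]; simp
    · rw [zero_cpow hs0, norm_zero]; positivity
  · rw [norm_cpow_eq_rpow_re_of_pos h]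
    exact Real.rpow_le_rpow h.le (hxM.trans (le_max_left _ _)) hs

/-- **Boundedness**: `‖W(s)‖ ≤ μ(ℝ)·max(M,1)^{Re s}` for `Re s ≥ 0` when `μ` lives on `[0, M]`.
[folklore] -/
theorem norm_cmoment_le [IsFiniteMeasure μ] {M : ℝ} (hμ : ∀ᵐ x ∂μ, 0 ≤ x ∧ x ≤ M) {s : ℂ}
    (hs : 0 ≤ s.re) : ‖cmoment μ s‖ ≤ (max M 1) ^ s.re * μ.real univ := by
  refine norm_integral_le_of_norm_le_const ?_
  filter_upwards [hμ] with x hx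
  exact norm_ofReal_cpow_le hx.1 hx.2 hs

/-- Integrability of `x^s` for `Re s ≥ 0`. [folklore] -/
theorem integrable_ofReal_cpow [IsFiniteMeasure μ] {M : ℝ} (hμ : ∀ᵐ x ∂μ, 0 ≤ x ∧ x ≤ M)
    {s : ℂ} (hs : 0 ≤ s.re) : Integrable (fun x : ℝ => (x : ℂ) ^ s) μ := by
  refine Integrable.mono' (integrable_const ((max M 1) ^ s.re))
    (measurable_ofReal_cpow s).aestronglyMeasurable ?_
  filter_upwards [hμ] with x hx
  exact norm_ofReal_cpow_le hx.1 hx.2 hs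

/-- The derivative integrand `x^s log x` is measurable. [folklore] -/
theorem measurable_ofReal_cpow_mul_log (s : ℂ) :
    Measurable fun x : ℝ => (x : ℂ) ^ s * Complex.log x :=
  (measurable_ofReal_cpow s).mul (Complex.measurable_log.comp Complex.measurable_ofReal)

/-- Uniform bound for the derivative integrand: for `0 ≤ x ≤ M` and `σ₀/2 ≤ Re s ≤ 3σ₀/2`
(`σ₀ > 0`), `‖x^s log x‖ ≤ 2/σ₀ + max(M,1)^{3σ₀/2} log max(M,1)`. [folklore] -/
theorem norm_cpow_mul_log_le {x M σ₀ : ℝ} (hσ₀ : 0 < σ₀) (hx0 : 0 ≤ x) (hxM : x ≤ M) {s : ℂ}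
    (hs1 : σ₀ / 2 ≤ s.re) (hs2 : s.re ≤ 3 * σ₀ / 2) :
    ‖(x : ℂ) ^ s * Complex.log x‖ ≤
      2 / σ₀ + (max M 1) ^ (3 * σ₀ / 2) * Real.log (max M 1) := by
  have hL1 : (1 : ℝ) ≤ max M 1 := le_max_right _ _
  have hA : 0 ≤ 2 / σ₀ := by positivity
  have hB : 0 ≤ (max M 1) ^ (3 * σ₀ / 2) * Real.log (max M 1) :=
    mul_nonneg (by positivity) (Real.log_nonneg hL1)
  have hsne : s ≠ 0 := by
    intro h; rw [h, zero_re] at hs1; linarith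
  rcases hx0.eq_or_lt with h | h
  · rw [← h, Complex.ofReal_zero, zero_cpow hsne, zero_mul, norm_zero]
    positivity
  · rw [norm_mul, norm_cpow_eq_rpow_re_of_pos h, (Complex.ofReal_log h.le).symm, norm_real,
      Real.norm_eq_abs]
    rcases le_or_gt x 1 with h1 | h1
    · -- `0 < x ≤ 1`: `x^{Re s} |log x| ≤ x^{σ₀/2} |log x| < 2/σ₀`
      have hpow : x ^ s.re ≤ x ^ (σ₀ / 2) :=
        Real.rpow_le_rpow_of_exponent_ge h h1 hs1
      have hlt := Real.abs_log_mul_self_rpow_lt x (σ₀ / 2) h h1 (by positivity)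
      rw [abs_mul, abs_of_nonneg (Real.rpow_nonneg h.le _)] at hlt
      calc x ^ s.re * |Real.log x| ≤ x ^ (σ₀ / 2) * |Real.log x| :=
            mul_le_mul_of_nonneg_right hpow (abs_nonneg _)
        _ = |Real.log x| * x ^ (σ₀ / 2) := mul_comm _ _
        _ ≤ 1 / (σ₀ / 2) := hlt.le
        _ = 2 / σ₀ := by field_simp
        _ ≤ _ := le_add_of_nonneg_right hB
    · -- `1 < x ≤ M`
      have hpow : x ^ s.re ≤ (max M 1) ^ (3 * σ₀ / 2) :=
        calc x ^ s.re ≤ (max M 1) ^ s.re :=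
              Real.rpow_le_rpow h.le (hxM.trans (le_max_left _ _)) (by linarith)
          _ ≤ (max M 1) ^ (3 * σ₀ / 2) := Real.rpow_le_rpow_of_exponent_le hL1 hs2
      have hlog : |Real.log x| ≤ Real.log (max M 1) := by
        rw [abs_of_nonneg (Real.log_nonneg h1.le)]
        exact Real.log_le_log h (hxM.trans (le_max_left _ _))
      calc x ^ s.re * |Real.log x| ≤ (max M 1) ^ (3 * σ₀ / 2) * Real.log (max M 1) :=
            mul_le_mul hpow hlog (abs_nonneg _) (by positivity)
        _ ≤ _ := le_add_of_nonneg_left hA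

/-- **Holomorphy**: `W` is complex differentiable at every `s₀` with `Re s₀ > 0`, with
`W'(s₀) = ∫ x^{s₀} log x dμ` (differentiation under the integral sign). [folklore] -/
theorem hasDerivAt_cmoment [IsFiniteMeasure μ] {M : ℝ} (hμ : ∀ᵐ x ∂μ, 0 ≤ x ∧ x ≤ M) {s₀ : ℂ}
    (hs₀ : 0 < s₀.re) :
    HasDerivAt (cmoment μ) (∫ x, (x : ℂ) ^ s₀ * Complex.log x ∂μ) s₀ := by
  set σ₀ := s₀.re with hσ₀
  have hball : ball s₀ (σ₀ / 2) ∈ 𝓝 s₀ := ball_mem_nhds _ (by positivity)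
  have hre : ∀ s ∈ ball s₀ (σ₀ / 2), σ₀ / 2 ≤ s.re ∧ s.re ≤ 3 * σ₀ / 2 := by
    intro s hs
    have h1 : |s.re - s₀.re| ≤ ‖s - s₀‖ := by
      simpa using abs_re_le_norm (s - s₀)
    have h2 : ‖s - s₀‖ < σ₀ / 2 := mem_ball_iff_norm.mp hs
    have h3 := abs_le.mp (h1.trans h2.le)
    constructor <;> linarith [h3.1, h3.2]
  have h := hasDerivAt_integral_of_dominated_loc_of_deriv_le (μ := μ)
    (F := fun s (x : ℝ) => (x : ℂ) ^ s) (F' := fun s (x : ℝ) => (x : ℂ) ^ s * Complex.log x)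
    (x₀ := s₀) (bound := fun _ => 2 / σ₀ + (max M 1) ^ (3 * σ₀ / 2) * Real.log (max M 1))
    hball (Eventually.of_forall fun s => (measurable_ofReal_cpow s).aestronglyMeasurable)
    (integrable_ofReal_cpow hμ hs₀.le) (measurable_ofReal_cpow_mul_log s₀).aestronglyMeasurable
    ?_ (integrable_const _) ?_
  · exact h.2
  · filter_upwards [hμ] with x hx s hs
    exact norm_cpow_mul_log_le hs₀ hx.1 hx.2 (hre s hs).1 (hre s hs).2
  · filter_upwards [hμ] with x hx s hs
    have hsne : s ≠ 0 := by
      intro h0; have := (hre s hs).1; rw [h0, zero_re] at this; linarith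
    exact (Complex.hasStrictDerivAt_const_cpow (Or.inr hsne)).hasDerivAt

/-- `W` is holomorphic on the open right half-plane. [folklore] -/
theorem differentiableOn_cmoment [IsFiniteMeasure μ] {M : ℝ} (hμ : ∀ᵐ x ∂μ, 0 ≤ x ∧ x ≤ M) :
    DifferentiableOn ℂ (cmoment μ) {s : ℂ | 0 < s.re} := fun _ hs =>
  (hasDerivAt_cmoment hμ hs).differentiableAt.differentiableWithinAt

/-- **Even moments**: `W(2k) = ∫ x^{2k} dμ`. [folklore] -/
theorem cmoment_two_mul_natCast (μ : Measure ℝ) (k : ℕ) :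
    cmoment μ (2 * k) = ((∫ x, x ^ (2 * k) ∂μ : ℝ) : ℂ) := by
  rw [cmoment, ← integral_complex_ofReal]
  refine integral_congr_ae (Eventually.of_forall fun x => ?_)
  simp only
  rw [show (2 : ℂ) * k = ((2 * k : ℕ) : ℂ) by push_cast; ring, cpow_natCast]
  push_cast
  ring

/-! ### A norm bound for polynomials -/

/-- `‖p(w)‖ ≤ (Σ_j ‖p_j‖) ‖w‖^{deg p}` for `‖w‖ ≥ 1`. [folklore] -/
theorem norm_eval_le_of_one_le (p : ℂ[X]) {w : ℂ} (hw : 1 ≤ ‖w‖) :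
    ‖p.eval w‖ ≤ (∑ j ∈ Finset.range (p.natDegree + 1), ‖p.coeff j‖) * ‖w‖ ^ p.natDegree := by
  rw [eval_eq_sum_range, Finset.sum_mul]
  refine (norm_sum_le _ _).trans (Finset.sum_le_sum fun j hj => ?_)
  rw [norm_mul, norm_pow]
  exact mul_le_mul_of_nonneg_left
    (pow_le_pow_right₀ hw (Nat.lt_succ_iff.mp (Finset.mem_range.mp hj))) (norm_nonneg _)

/-! ### The lifting theorem -/

section Lift

variable [IsFiniteMeasure μ] {M : ℝ} {d : ℕ} {P : ℕ → ℂ[X]}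

/-- The left-hand side `G(u) = Σ_i P_i(u) W(2u + 2i)` of the functional equation in the variable
`u = s/2`. [folklore] -/
def liftFun (μ : Measure ℝ) (d : ℕ) (P : ℕ → ℂ[X]) (u : ℂ) : ℂ :=
  ∑ i ∈ Finset.range (d + 1), (P i).eval u * cmoment μ (2 * u + 2 * i)

/-- `G` is holomorphic on `Re u > 0`. [folklore] -/
theorem differentiableAt_liftFun (hμ : ∀ᵐ x ∂μ, 0 ≤ x ∧ x ≤ M) {u : ℂ} (hu : 0 < u.re) :
    DifferentiableAt ℂ (liftFun μ d P) u := by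
  unfold liftFun
  refine DifferentiableAt.fun_sum fun i _ => ?_
  refine (P i).differentiableAt.mul ?_
  have h2 : DifferentiableAt ℂ (fun u : ℂ => 2 * u + 2 * (i : ℂ)) u := by fun_prop
  have h3 : DifferentiableAt ℂ (cmoment μ) (2 * u + 2 * (i : ℂ)) :=
    (hasDerivAt_cmoment hμ (by simp; linarith)).differentiableAt
  have h4 : DifferentiableAt ℂ (cmoment μ ∘ fun u : ℂ => 2 * u + 2 * (i : ℂ)) u := h3.comp u h2
  exact h4

omit [IsFiniteMeasure μ] in
/-- `G(k) = 0` at the naturals: the recursion of the even moments. [folklore] -/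
theorem liftFun_natCast
    (hrec : ∀ k : ℕ, ∑ i ∈ Finset.range (d + 1),
      (P i).eval (k : ℂ) * ((∫ x, x ^ (2 * (k + i)) ∂μ : ℝ) : ℂ) = 0)
    (k : ℕ) : liftFun μ d P k = 0 := by
  unfold liftFun
  rw [← hrec k]
  refine Finset.sum_congr rfl fun i _ => ?_
  rw [show 2 * (k : ℂ) + 2 * (i : ℂ) = 2 * ((k + i : ℕ) : ℂ) by push_cast; ring,
    cmoment_two_mul_natCast]

/-- The Carlson function `F(u) = max(M,1)^{−(2u+2+2d)} (u+2)^{−N} G(u+1)`. [folklore] -/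
def carlsonLift (μ : Measure ℝ) (M : ℝ) (d : ℕ) (P : ℕ → ℂ[X]) (u : ℂ) : ℂ :=
  cexp (-(2 * u + 2 + 2 * d) * Real.log (max M 1)) *
    ((u + 2) ^ (∑ i ∈ Finset.range (d + 1), (P i).natDegree))⁻¹ * liftFun μ d P (u + 1)

/-- `‖exp(−(2u+2+2d) log L)‖ = L^{−(2 Re u + 2 + 2d)}`. [folklore] -/
theorem norm_cexp_neg_mul_log (u : ℂ) (d : ℕ) {L : ℝ} (hL : 0 < L) :
    ‖cexp (-(2 * u + 2 + 2 * d) * Real.log L)‖ = L ^ (-(2 * u.re + 2 + 2 * d)) := by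
  have h2 : (-(2 * u + 2 + 2 * (d : ℂ)) : ℂ).re = -(2 * u.re + 2 + 2 * d) := by simp
  rw [norm_exp, re_mul_ofReal, h2, Real.rpow_def_of_pos hL]
  congr 1
  ring

/-- **Boundedness of the Carlson function on `Re u ≥ 0`**. [folklore] -/
theorem norm_carlsonLift_le (hμ : ∀ᵐ x ∂μ, 0 ≤ x ∧ x ≤ M) {u : ℂ} (hu : 0 ≤ u.re) :
    ‖carlsonLift μ M d P u‖ ≤
      (∑ i ∈ Finset.range (d + 1), ∑ j ∈ Finset.range ((P i).natDegree + 1), ‖(P i).coeff j‖) *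
        μ.real univ := by
  set L := max M 1 with hL
  set N := ∑ i ∈ Finset.range (d + 1), (P i).natDegree with hN
  set C := ∑ i ∈ Finset.range (d + 1), ∑ j ∈ Finset.range ((P i).natDegree + 1), ‖(P i).coeff j‖
    with hC
  have hL1 : (1 : ℝ) ≤ L := le_max_right _ _
  have hL0 : (0 : ℝ) < L := by linarith
  have hC0 : 0 ≤ C := Finset.sum_nonneg fun i _ => Finset.sum_nonneg fun j _ => norm_nonneg _
  -- `1 ≤ ‖u+1‖ ≤ ‖u+2‖`
  have hw1 : 1 ≤ ‖u + 1‖ := by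
    calc (1 : ℝ) ≤ |(u + 1).re| := by
          rw [add_re, one_re]; exact le_trans (by linarith) (le_abs_self _)
      _ ≤ ‖u + 1‖ := abs_re_le_norm _
  have hw12 : ‖u + 1‖ ≤ ‖u + 2‖ := by
    rw [← sq_le_sq₀ (norm_nonneg _) (norm_nonneg _), Complex.sq_norm, Complex.sq_norm,
      normSq_apply, normSq_apply]
    simp only [add_re, one_re, add_im, one_im, re_ofNat, im_ofNat]
    nlinarith
  have hw2 : 1 ≤ ‖u + 2‖ := hw1.trans hw12
  have hw2pos : 0 < ‖u + 2‖ := by linarith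
  -- the bound on `G(u+1)`
  have hG : ‖liftFun μ d P (u + 1)‖ ≤ C * ‖u + 2‖ ^ N * (L ^ (2 * u.re + 2 + 2 * d) * μ.real univ) := by
    unfold liftFun
    refine (norm_sum_le _ _).trans ?_
    rw [hC, Finset.sum_mul, Finset.sum_mul]
    refine Finset.sum_le_sum fun i hi => ?_
    have hid : i ≤ d := Nat.lt_succ_iff.mp (Finset.mem_range.mp hi)
    rw [norm_mul]
    have hP : ‖(P i).eval (u + 1)‖ ≤
        (∑ j ∈ Finset.range ((P i).natDegree + 1), ‖(P i).coeff j‖) * ‖u + 2‖ ^ N := by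
      refine (norm_eval_le_of_one_le (P i) hw1).trans ?_
      refine mul_le_mul_of_nonneg_left ?_ (Finset.sum_nonneg fun _ _ => norm_nonneg _)
      have hNi : (P i).natDegree ≤ N := by
        rw [hN]
        exact Finset.single_le_sum (f := fun j => (P j).natDegree) (fun _ _ => Nat.zero_le _) hi
      calc ‖u + 1‖ ^ (P i).natDegree ≤ ‖u + 2‖ ^ (P i).natDegree :=
            pow_le_pow_left₀ (norm_nonneg _) hw12 _
        _ ≤ ‖u + 2‖ ^ N := pow_le_pow_right₀ hw2 hNi
    have hW : ‖cmoment μ (2 * (u + 1) + 2 * i)‖ ≤ L ^ (2 * u.re + 2 + 2 * d) * μ.real univ := by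
      have h := norm_cmoment_le hμ (s := 2 * (u + 1) + 2 * i) (by simp; linarith)
      have hre : (2 * (u + 1) + 2 * (i : ℂ)).re = 2 * u.re + 2 + 2 * i := by simp; ring
      rw [hre] at h
      refine h.trans (mul_le_mul_of_nonneg_right ?_ measureReal_nonneg)
      have hid' : (i : ℝ) ≤ d := by exact_mod_cast hid
      exact Real.rpow_le_rpow_of_exponent_le hL1 (by linarith)
    exact mul_le_mul hP hW (norm_nonneg _) (by positivity)
  -- assemble
  unfold carlsonLift
  rw [norm_mul, norm_mul, norm_cexp_neg_mul_log u d hL0, norm_inv, norm_pow]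
  have hLpow : L ^ (-(2 * u.re + 2 + 2 * d)) * L ^ (2 * u.re + 2 + 2 * d) = 1 := by
    rw [← Real.rpow_add hL0, show -(2 * u.re + 2 + 2 * (d : ℝ)) + (2 * u.re + 2 + 2 * d) = 0 by ring,
      Real.rpow_zero]
  calc L ^ (-(2 * u.re + 2 + 2 * d)) * (‖u + 2‖ ^ N)⁻¹ * ‖liftFun μ d P (u + 1)‖
      ≤ L ^ (-(2 * u.re + 2 + 2 * d)) * (‖u + 2‖ ^ N)⁻¹ *
          (C * ‖u + 2‖ ^ N * (L ^ (2 * u.re + 2 + 2 * d) * μ.real univ)) :=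
        mul_le_mul_of_nonneg_left hG (by positivity)
    _ = (L ^ (-(2 * u.re + 2 + 2 * d)) * L ^ (2 * u.re + 2 + 2 * d)) * C * μ.real univ := by
        field_simp
    _ = C * μ.real univ := by rw [hLpow, one_mul]

/-- The Carlson function is holomorphic on `Re u > −1/2`. [folklore] -/
theorem differentiableOn_carlsonLift (hμ : ∀ᵐ x ∂μ, 0 ≤ x ∧ x ≤ M) :
    DifferentiableOn ℂ (carlsonLift μ M d P) {u : ℂ | -(1 / 2 : ℝ) < u.re} := by
  intro u hu
  have hu' : -(1 / 2 : ℝ) < u.re := hu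
  have hG : DifferentiableAt ℂ (fun u : ℂ => liftFun μ d P (u + 1)) u :=
    (differentiableAt_liftFun hμ (by simp; linarith)).comp u (differentiableAt_id.add_const 1)
  have hne : (u + 2) ^ (∑ i ∈ Finset.range (d + 1), (P i).natDegree) ≠ 0 := by
    apply pow_ne_zero
    intro h
    have := congrArg Complex.re h
    simp at this
    linarith
  have hinv : DifferentiableAt ℂ
      (fun u : ℂ => ((u + 2) ^ (∑ i ∈ Finset.range (d + 1), (P i).natDegree))⁻¹) u :=
    ((differentiableAt_id.add_const 2).pow _).inv hne
  have hexp : DifferentiableAt ℂ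
      (fun u : ℂ => cexp (-(2 * u + 2 + 2 * d) * Real.log (max M 1))) u := by
    fun_prop
  exact ((hexp.mul hinv).mul hG).differentiableWithinAt

/-- **Polynomial recursions of the even moments lift to functional equations** (Carlson):
if `μ` is a finite measure carried by `[0, M]` and `Σ_{i ≤ d} P_i(k) ∫ x^{2(k+i)} dμ = 0` for all
`k ∈ ℕ`, then `Σ_{i ≤ d} P_i(s/2) W(s + 2i) = 0` for all `Re s > 0`, `W(s) = ∫ x^s dμ`.
[cite: BorweinEtAl2012, §2 (functional equation of W_n from the recursion of W_n(2k), via Carlson's theorem)] -/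
theorem cmoment_functionalEquation (hμ : ∀ᵐ x ∂μ, 0 ≤ x ∧ x ≤ M)
    (hrec : ∀ k : ℕ, ∑ i ∈ Finset.range (d + 1),
      (P i).eval (k : ℂ) * ((∫ x, x ^ (2 * (k + i)) ∂μ : ℝ) : ℂ) = 0)
    {s : ℂ} (hs : 0 < s.re) :
    ∑ i ∈ Finset.range (d + 1), (P i).eval (s / 2) * cmoment μ (s + 2 * i) = 0 := by
  -- Step 1: Carlson ⇒ `G(u + 1) = 0` for `Re u ≥ 0`
  have hC : ∀ u : ℂ, 0 ≤ u.re → liftFun μ d P (u + 1) = 0 := by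
    intro u hu
    have h := AndrewsAskeyRoy1999_thm_2_8_1_holds (carlsonLift μ M d P)
      ⟨{u : ℂ | -(1 / 2 : ℝ) < u.re}, isOpen_lt continuous_const continuous_re,
        fun u (hu : 0 ≤ u.re) => show -(1 / 2 : ℝ) < u.re by linarith,
        differentiableOn_carlsonLift hμ⟩
      ⟨_, fun u hu => norm_carlsonLift_le hμ hu⟩
      (fun n => by
        unfold carlsonLift
        rw [show (n : ℂ) + 1 = ((n + 1 : ℕ) : ℂ) by push_cast; ring, liftFun_natCast hrec,
          mul_zero])
      u hu
    unfold carlsonLift at h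
    rcases mul_eq_zero.mp h with h' | h'
    · rcases mul_eq_zero.mp h' with h'' | h''
      · exact absurd h'' (exp_ne_zero _)
      · exfalso
        rw [inv_eq_zero] at h''
        refine (pow_ne_zero _ ?_) h''
        intro h0
        have := congrArg Complex.re h0
        simp at this
        linarith
    · exact h'
  -- Step 2: identity theorem on `Re u > 0`
  have hDo : DifferentiableOn ℂ (liftFun μ d P) {u : ℂ | 0 < u.re} :=
    fun u hu => (differentiableAt_liftFun hμ hu).differentiableWithinAt
  have hD : AnalyticOnNhd ℂ (liftFun μ d P) {u : ℂ | 0 < u.re} :=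
    hDo.analyticOnNhd (isOpen_lt continuous_const continuous_re)
  have hev : liftFun μ d P =ᶠ[𝓝 (2 : ℂ)] 0 := by
    have hmem : {u : ℂ | 1 < u.re} ∈ 𝓝 (2 : ℂ) :=
      (isOpen_lt continuous_const continuous_re).mem_nhds
        (by show (1 : ℝ) < (2 : ℂ).re; norm_num)
    filter_upwards [hmem] with u hu
    have := hC (u - 1) (by simp; linarith)
    simpa using this
  have hEq := hD.eqOn_zero_of_preconnected_of_eventuallyEq_zero
    (convex_halfSpace_re_gt 0).isPreconnected (by show (0 : ℝ) < (2 : ℂ).re; norm_num) hev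
  have h0 : liftFun μ d P (s / 2) = 0 := hEq (by simp only [mem_setOf_eq, div_ofNat_re]; linarith)
  unfold liftFun at h0
  rw [show 2 * (s / 2) = s by ring] at h0
  exact h0

end Lift

end Literature.Analysis.Moments

end
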